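import Literature.MathematicalPhysics.QuantumFieldTheory.Balaban1983to89.B6Prop22MultiLevelTorus
import Literature.MathematicalPhysics.QuantumFieldTheory.Balaban1983to89.B6Prop22DerivMultiLevelBox

/-!
# `Balaban1983to89.B6Prop22DerivMultiLevelTorus` — [B6] PROPOSITION 2.2, SECOND ENTRY OF (2.67) (`|∇^η_xG′λ|`), FOR
THE GENUINE `k`-LEVEL OPERATOR `G′ = Δ′_a^{−1}` ON THE TORUS `T_η`: `|(G′λ)(x + e_μ) − (G′λ)(x)| ≤ O(1)L^jη
e^{−½δ₀d(y,y′)}|λ|`, `x ∈ B^j(y)`, `supp λ ⊂ B^{j′}(y′)`, with the PERIODIC forward difference — by the printed route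
(2.64)–(2.66) applied to `∂G′ = ∂G′₀ + (∂G′)R`, every transported cube term read in its translation chart (files T1–T4),
where the box lineage's product rule / (2.43)₁ / (2.43)₂ bound applies verbatim (file T6 of the torus carrier of the
multi-level parametrix; no existing module is touched; no fact is minted)

FRAMING (verbatim cell line):
statement-level skeleton of published theorems with citation tags; proofs where landed; nothing here is a claim about the Yang–Mills mass gap

Source under audit (cell pub-balaban / lit-balaban): T. Bałaban, *Propagators and renormalization transformations for
lattice gauge theories. II*, Commun. Math. Phys. **96** (1984) 223–250 [`Balaban1984PropagatorsII`, "B6"], p. 224 [PDF 2]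
(«we admit the case when some domains Ω_j are equal to T_η»), p. 229–230 [PDF 7–8] (2.36)–(2.44), p. 234 [PDF 12]
(2.64)–(2.67), Proposition 2.2 (held text `paper:balaban1984-cmp96-propagators-rt-ii`, p0002/p0007/p0008/p0012); T. Bałaban,
*Regularity and decay of lattice Green's functions*, Commun. Math. Phys. **89** (1983) 571–597 [`Balaban1983RegularityDecay`],
(2.6) p. 576 (the margin of the partition).  Unit `lit-balaban-p21` (Phase-2 proof seat p21 gen 15), HOME
`run/shared/lean/pub/lit-balaban/`, B6 fold owner r03, referee ref-4.  Box sibling (consumed BY NAME, untouched):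
`B6Prop22DerivMultiLevelBox` (p21 gen 10: `dMat`, `img_of_uX_ne_zero`, `dMat_gZeroML_majorant`, `prop22_second_multiLevelBox`).

## WHAT IS PRINTED (p. 234, verbatim up to notation)

«**Proposition 2.2.** If we have (2.1), (2.2) and M is sufficiently large, then the operator G′ = Δ′_a^{−1} (a = 1)
satisfies the inequalities |(G′λ)(x)|, |(∇^η_xG′λ)(x)|, … ≤ O(1)[(L^jη)², L^jη, …]·e^{−½δ₀d(y,y′)}|λ|, x ∈ B^j(y) …,
y ∈ Λ_j, supp λ ⊂ B^{j′}(y′), y′ ∈ Λ_{j′}. (2.67)» (second entry: the factor «L^jη»); (2.66): «… and similar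
inequalities for the derivatives ∇^η_xG′λ … of course with properly changed first factors on the right sides.»

## WHAT THIS FILE CERTIFIES (kernel-checked; setting of files T1–T4)

For the genuine operator `Δ′_a = mlOpT` of a nested family `D : TDomains d ℓ M_h k P R` on the torus, `G′₀ = gZeroT`,
`R = rT`, `G′ = gmlT`, the torus blocks `𝔅` and distance `d_T` of `geomT D`:
* §2 **THE PERIODIC FORWARD DIFFERENCE** `dT N μ = S_{e_μ} − 1` (`(∂_μf)(x) = f(x + e_μ mod N) − f(x)`, `dT_mulVec`; no
  boundary case on the torus), its commutation with the chart translations (`σc_symm_tshift`), and the wall bookkeeping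
  (`wall_of_not_mem`, `not_interior_of_not_mem`, `not_interior_tshift_of_not_mem`: a chart point whose lattice
  neighbour leaves the fundamental box, and its periodic neighbour, are wall sites — where every central cube term
  vanishes);
* §3 **THE ROW SUPPORT OF A BOND TERM**: the box lineage's finite-overlap lemma strengthened to a lattice neighbour
  (`mem_keySet_of_uX_ne_zero_nbr`: `h_□(w) ≠ 0` and `z` a neighbour of `w` ⇒ `□` is keyed at `z`, by the ⅝-margin of
  the (1.118) profile), hence on the torus `mem_keySet_of_dT_aT_ne_zero`: at most `3·2^{d+1}` transported terms
  `σ(h_□G′(□)v_□)σ⁻¹` have a non-zero `μ`-difference at the row of `x`;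
* §4 **THE MAJORANT OF `∂G′₀` ON THE TORUS** `dT_gZeroT_majorant`: `A·L^{j}·e^{−δ₃d_T(y,y′)/(d+1)}` with `(δ₃, A)`
  functions of `d`, `ℓ`, windows only — per term, in the chart, the box lineage's product rule with (2.43)₁ at
  `x′ + e_μ` and (2.43)₂ at `x′` (`ineq243_twoLevel_roww`, `ineq243_twoLevel_deriv_wsum`), `|∂h_□| ≤ (d+1)D₁/L^{j_□}`,
  the lattice-unit factors, the support distance read from `d_{chart} ≥ d_T`;
* §5 **PROPOSITION 2.2, SECOND ENTRY, ON THE TORUS** `prop22_second_multiLevelTorus`: there are `δ₀, C, M₀ > 0` and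
  `N₀` (functions of `d`, `ℓ`, windows — not of the torus) such that for every `k`, `M_h ≥ 3` with `L·M_h ≥ M₀`,
  `R ≥ 2L` with `RM ≥ N₀ + 1`, torus size `P` (`P_μ ≥ 4`), nested family `D` of domains of the torus, weights in the
  windows with `a_{i+1} = aNext ℓ a_i c_i`, and axis `μ`: `|(G′λ)(x + e_μ) − (G′λ)(x)| ≤ C·L^{j}·e^{−½δ₀d_T(y,y′)}|λ|`
  for `x ∈ B^j(y)`, `supp λ ⊂ B^{j′}(y′)` (`x + e_μ` read on the torus) — the differentiated fixed point
  `∂G′ = ∂G′₀ + (∂G′)R` (`fixedPoint_dT_gmlT`) fed, with §4, file T4's `rT_majorant` and Lemma 2.1 on the torus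
  (`lemma21_torus`, `α = ½`), to the chain `B6Prop23Chain.majorant_of_fixedPoint_266W`.

## HONEST SCOPE

As files T1–T4: levels `1 … k` with `Ω₁ = T_η`, `m² = 0`, `M_h ≥ 3`, `P_μ ≥ 4`, the asymmetric partition; lattice units
(`G′` here is `η^{−2}G′` of print and `∂ = η∇^η`, whence `L^{j}` for «L^jη»); constants existential (functions of `d`,
`ℓ`, windows).  Only the forward differences `∂_μ`, `μ = 0 … d`, are certified (print's `∇^η` is the vector of these).
Nothing is inferred from the manuscript: every step is kernel-checked.
-/

namespace Literature.MathematicalPhysics.QuantumFieldTheory.Balaban1983to89.B6Prop22DerivMultiLevelTorus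

open Finset Matrix
open Literature.MathematicalPhysics.QuantumFieldTheory.Balaban1983to89.B4ContourShift (supNorm abs_le_supNorm
  supNorm_nonneg)
open Literature.MathematicalPhysics.QuantumFieldTheory.Balaban1983to89.B4Reflection242 (boxDom mem_boxDom blk nbrs
  mem_nbrs)
open Literature.MathematicalPhysics.QuantumFieldTheory.Balaban1983to89.B4Lemma22ReduceZero (Box)
open Literature.MathematicalPhysics.QuantumFieldTheory.Balaban1983to89.B4PartitionUnity22 (hprof D1 D2 D1_nonneg D2_nonneg
  contDiff_hprof hasCompactSupport_hprof)
open Literature.MathematicalPhysics.QuantumFieldTheory.Balaban1983to89.B4Thm110ZeroBox (boxCast boxCast_apply_val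
  boxCast_symm_apply_val mem_boxDom_of_eq roww mulVec_le_of_roww)
open Literature.MathematicalPhysics.QuantumFieldTheory.Balaban1983to89.B4Thm110ZeroBoxDeriv (supNorm_single_le
  supNorm_sub_le_nbr)
open Literature.MathematicalPhysics.QuantumFieldTheory.Balaban1983to89.B6Ineq243TwoLevelBox
open Literature.MathematicalPhysics.QuantumFieldTheory.Balaban1983to89.B6Partition236TwoLevelBox
open Literature.MathematicalPhysics.QuantumFieldTheory.Balaban1983to89.B6Eq238TwoLevelBox
open Literature.MathematicalPhysics.QuantumFieldTheory.Balaban1983to89.B6Ineq249TwoLevelBox (near card_near_le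
  mem_near_of_abs_lt emb_sub_emb)
open Literature.MathematicalPhysics.QuantumFieldTheory.Balaban1983to89.B6MultiLevelBoxOperator
open Literature.MathematicalPhysics.QuantumFieldTheory.Balaban1983to89.B6Eq238MultiLevelBox
open Literature.MathematicalPhysics.QuantumFieldTheory.Balaban1983to89.B6Ineq249MultiLevelBox
open Literature.MathematicalPhysics.QuantumFieldTheory.Balaban1983to89.B6Geom246MultiLevelBox
open Literature.MathematicalPhysics.QuantumFieldTheory.Balaban1983to89.B6Prop22MultiLevelBox
open Literature.MathematicalPhysics.QuantumFieldTheory.Balaban1983to89.B6Prop22DerivMultiLevelBox (img_of_uX_ne_zero)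
open Literature.MathematicalPhysics.QuantumFieldTheory.Balaban1983to89.B6RandomWalk (HasMajorant BlockSupp
  hasMajorant_mono)
open Literature.MathematicalPhysics.QuantumFieldTheory.Balaban1983to89.B6Ineq261LevelGap (K261 K261_nonneg
  theta_lt_one_of_log)
open Literature.MathematicalPhysics.QuantumFieldTheory.Balaban1983to89.B6Prop23Chain (majorant_of_fixedPoint_266W)
open Literature.MathematicalPhysics.QuantumFieldTheory.Balaban1983to89.B6MultiLevelTorusOperator
open Literature.MathematicalPhysics.QuantumFieldTheory.Balaban1983to89.B6Eq238MultiLevelTorus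
open Literature.MathematicalPhysics.QuantumFieldTheory.Balaban1983to89.B6Geom246MultiLevelTorus
open Literature.MathematicalPhysics.QuantumFieldTheory.Balaban1983to89.B6Prop22MultiLevelTorus

noncomputable section

variable {d : ℕ}

/-! ## §1 Tools -/

section Tools

/-- a sum over a finite type whose non-zero terms are indexed injectively into a finset `T` and are bounded by
`B ≥ 0` is at most `|T|·B`. [folklore] -/
private theorem sum_le_card_mul {ι σ : Type*} [Fintype ι] [DecidableEq σ] (f : ι → ℝ) (key : ι → σ)
    (hkey : Function.Injective key) (T : Finset σ) (hT : ∀ i, f i ≠ 0 → key i ∈ T) {B : ℝ} (hB : 0 ≤ B)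
    (hf : ∀ i, f i ≤ B) : ∑ i, f i ≤ T.card * B := by
  classical
  rw [← Finset.sum_filter_ne_zero]
  have hcard : (Finset.univ.filter fun i => f i ≠ 0).card ≤ T.card :=
    Finset.card_le_card_of_injOn key (fun i hi => by
      rw [Finset.coe_filter] at hi; exact hT i hi.2) (fun i _ j _ h => hkey h)
  calc ∑ i ∈ Finset.univ.filter (fun i => f i ≠ 0), f i
      ≤ (Finset.univ.filter fun i => f i ≠ 0).card • B := Finset.sum_le_card_nsmul _ _ _ fun i _ => hf i
    _ = ((Finset.univ.filter fun i => f i ≠ 0).card : ℝ) * B := by rw [nsmul_eq_mul]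
    _ ≤ T.card * B := mul_le_mul_of_nonneg_right (by exact_mod_cast hcard) hB

/-- a weighted `ℓ¹` row bound gives decay against bounded vectors supported at sup-distance `≥ D` from the base point.
[folklore] -/
private theorem sum_mul_le_of_wrow {X : Type*} [Fintype X] {δ n c F Dd : ℝ} (hn : 0 < n) (hF0 : 0 ≤ F)
    (r u : X → ℝ) (dist : X → ℝ) (hrow : ∑ z, |r z| * Real.exp (δ * dist z / n) ≤ c)
    (hF : ∀ z, |u z| ≤ F) (hD : ∀ z, u z ≠ 0 → Dd ≤ dist z) (hδ : 0 ≤ δ) :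
    |∑ z, r z * u z| ≤ c * Real.exp (-(δ * Dd / n)) * F := by
  have hterm : ∀ z, |r z * u z| ≤ |r z| * Real.exp (δ * dist z / n) * (Real.exp (-(δ * Dd / n)) * F) := by
    intro z
    by_cases hz : u z = 0
    · rw [hz, mul_zero, abs_zero]; positivity
    rw [abs_mul]
    have h1 : 1 ≤ Real.exp (δ * dist z / n) * Real.exp (-(δ * Dd / n)) := by
      rw [← Real.exp_add]
      refine Real.one_le_exp ?_
      have := div_le_div_of_nonneg_right (mul_le_mul_of_nonneg_left (hD z hz) hδ) hn.le
      linarith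
    calc |r z| * |u z| ≤ |r z| * (1 * F) := by
          rw [one_mul]; exact mul_le_mul_of_nonneg_left (hF z) (abs_nonneg _)
      _ ≤ |r z| * (Real.exp (δ * dist z / n) * Real.exp (-(δ * Dd / n)) * F) :=
          mul_le_mul_of_nonneg_left (mul_le_mul_of_nonneg_right h1 hF0) (abs_nonneg _)
      _ = |r z| * Real.exp (δ * dist z / n) * (Real.exp (-(δ * Dd / n)) * F) := by ring
  calc |∑ z, r z * u z| ≤ ∑ z, |r z * u z| := Finset.abs_sum_le_sum_abs _ _
    _ ≤ ∑ z, |r z| * Real.exp (δ * dist z / n) * (Real.exp (-(δ * Dd / n)) * F) :=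
        Finset.sum_le_sum fun z _ => hterm z
    _ = (∑ z, |r z| * Real.exp (δ * dist z / n)) * (Real.exp (-(δ * Dd / n)) * F) := by rw [Finset.sum_mul]
    _ ≤ c * (Real.exp (-(δ * Dd / n)) * F) := mul_le_mul_of_nonneg_right hrow (by positivity)
    _ = c * Real.exp (-(δ * Dd / n)) * F := by ring

/-- the exponent bookkeeping: `e^{−δD/L^i} = e^{δ}·e^{−(δ/(d+1))·dist}` for `D = L^i(dist/(d+1) − 1)`. [folklore] -/
private theorem exp_Dd_eq {δ n dist : ℝ} (hn : 0 < n) (d : ℕ) :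
    Real.exp (-(δ * (n * (dist / (d + 1) - 1)) / n)) = Real.exp δ * Real.exp (-(δ / (d + 1) * dist)) := by
  rw [← Real.exp_add]
  congr 1
  field_simp
  ring

/-- the shift by one lattice step: `e^{−δ(D−1)/n} ≤ e^{δ}·e^{−δD/n}` for `n ≥ 1`, `δ ≥ 0`. [folklore] -/
private theorem exp_shift_le {δ n Dd : ℝ} (hδ : 0 ≤ δ) (hn : 1 ≤ n) :
    Real.exp (-(δ * (Dd - 1) / n)) ≤ Real.exp δ * Real.exp (-(δ * Dd / n)) := by
  rw [← Real.exp_add, Real.exp_le_exp]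
  have hn0 : 0 < n := by linarith
  have h1 : -(δ * (Dd - 1) / n) = -(δ * Dd / n) + δ / n := by
    field_simp
    ring
  rw [h1]
  have : δ / n ≤ δ := div_le_self hδ hn
  linarith

/-- the weakening of a rate against a non-negative distance. [folklore] -/
private theorem exp_rate_mono {δ δ' dist : ℝ} (hδ : δ' ≤ δ) (hdist : 0 ≤ dist) (d : ℕ) :
    Real.exp (-(δ / (d + 1) * dist)) ≤ Real.exp (-(δ' / (d + 1) * dist)) := by
  rw [Real.exp_le_exp, neg_le_neg_iff]
  exact mul_le_mul_of_nonneg_right (div_le_div_of_nonneg_right hδ (by positivity)) hdist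

/-- `(reindex e e A)·v` at `z` is `A·(v ∘ e)` at `e⁻¹z`. [folklore] -/
private theorem reindex_mulVec_apply {X Y : Type*} [Fintype X] [Fintype Y] (e : X ≃ Y) (A : Matrix X X ℝ) (v : Y → ℝ)
    (z : Y) : (Matrix.reindex e e A *ᵥ v) z = (A *ᵥ (v ∘ e)) (e.symm z) := by
  rw [Matrix.reindex_apply, Matrix.submatrix_mulVec_equiv, Equiv.symm_symm, Function.comp_apply]

end Tools

/-! ## §2 The periodic forward difference and the wall bookkeeping of a chart -/

section Diff

variable {N : Fin (d + 1) → ℕ}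

variable (N) in
/-- **THE PERIODIC FORWARD DIFFERENCE** `∂_μ = S_{e_μ} − 1` on the torus `Π_μ[0, N_μ)`: `(∂_μf)(x) = f(x + e_μ mod N) − f(x)`
(`∇^η = η^{−1}∂` in lattice units; no boundary case). [cite: Balaban1984PropagatorsII, (2.67) p.234 (the entry ∇^η_xG′λ), dictionary] -/
def dT (μ : Fin (d + 1)) : Matrix ↥(boxDom N) ↥(boxDom N) ℝ := shiftMat N (unitVec μ) - 1

/-- `(∂_μf)(x) = f(σ_{e_μ}x) − f(x)`. [cite: Balaban1984PropagatorsII, (2.67) p.234, dictionary] -/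
theorem dT_mulVec (μ : Fin (d + 1)) (f : ↥(boxDom N) → ℝ) (x : ↥(boxDom N)) :
    (dT N μ *ᵥ f) x = f (tshift N (unitVec μ) x) - f x := by
  unfold dT
  rw [Matrix.sub_mulVec, Pi.sub_apply, shiftMat_mulVec, Matrix.one_mulVec]

/-- torus translations commute: `σ_s⁻¹(σ_t z) = σ_t(σ_s⁻¹ z)`. [cite: Balaban1983RegularityDecay, p.572 («a torus T_η … with periodic conditions»), dictionary] -/
theorem tshift_symm_tshift (N : Fin (d + 1) → ℕ) (s t : Fin (d + 1) → ℤ) (z : ↥(boxDom N)) :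
    (tshift N s).symm (tshift N t z) = tshift N t ((tshift N s).symm z) := by
  rw [tshift_symm_apply, tshift_symm_apply, tshift_tshift, tshift_tshift, add_comm t (-s)]

/-- a box point whose lattice `μ`-neighbour leaves the box sits on the far `μ`-wall (elementary lattice bookkeeping of
the fundamental box). [cite: Balaban1984PropagatorsII, p.229, dictionary] -/
theorem wall_of_not_mem {x : ↥(boxDom N)} {μ : Fin (d + 1)} (h : x.1 + Pi.single μ 1 ∉ boxDom N) :
    x.1 μ + 1 = N μ := by
  by_contra hne
  apply h
  rw [mem_boxDom]
  intro i
  have hx := (mem_boxDom.1 x.2) i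
  by_cases hi : i = μ
  · subst hi
    rw [Pi.add_apply, Pi.single_eq_same]
    have hxμ := (mem_boxDom.1 x.2) i
    omega
  · rw [Pi.add_apply, Pi.single_eq_of_ne hi, add_zero]
    exact hx

/-- … so it is not an interior site. [cite: Balaban1984PropagatorsII, p.229, dictionary] -/
theorem not_interior_of_not_mem {x : ↥(boxDom N)} {μ : Fin (d + 1)} (h : x.1 + Pi.single μ 1 ∉ boxDom N) :
    ¬ Interior N x := fun hI => by
  have h1 := (hI μ).2
  have h2 := wall_of_not_mem h
  omega

/-- … and its periodic `μ`-neighbour sits on the near `μ`-wall, not an interior site either. [cite: Balaban1984PropagatorsII, p.229, dictionary] -/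
theorem not_interior_tshift_of_not_mem {x : ↥(boxDom N)} {μ : Fin (d + 1)} (h : x.1 + Pi.single μ 1 ∉ boxDom N) :
    ¬ Interior N (tshift N (unitVec μ) x) := fun hI => by
  have h1 := (hI μ).1
  rw [tshift_val] at h1
  simp only [twrap, Pi.add_apply, unitVec, Pi.single_eq_same] at h1
  rw [wall_of_not_mem h, Int.emod_self] at h1
  omega

end Diff

/-! ## §3 The row support of a bond term: the finite overlap at a lattice neighbour, and on the torus -/

section Support

variable {ℓ Mh k R : ℕ} {P : Fin (d + 1) → ℕ}

/-- **THE FINITE OVERLAP AT A NEIGHBOUR**: if `h_□(w) ≠ 0` for the member `□ = (j, q)` of the box cover and `z` is `w` or a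
lattice neighbour of `w` in the box, then `j ∈ {lev z − 1, lev z, lev z + 1}` and `q` is one of the `2^{d+1}` candidate
centres AT `z` (the ⅝-margin of the (1.118) profile: `|z + ½ − N_jq| < ⅝N_j + 1 ≤ N_j`; `z` lies in the cube image by
the [3] (2.6) margin). [cite: Balaban1984PropagatorsII, p.229 (cover of finite overlap); Balaban1983RegularityDecay, (2.6) p.576] -/
theorem mem_keySet_of_uX_ne_zero_nbr {D' : Domains d ℓ Mh k P R} (hℓ : 1 ≤ ℓ) (hR : 2 * (ℓ + 1) ≤ R)
    (hP : ∀ μ, 1 ≤ P μ) (hMh : 1 ≤ Mh) (cq : ℕ × (Fin (d + 1) → ℤ)) (hc : CubeData D' cq)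
    {z w : ↥(boxDom (N0 ℓ Mh k P))} (hu : uX (ℓ := ℓ) (Mh := Mh) (k := k) (P := P) cq w ≠ 0)
    (hzw : z.1 ∈ nbrs w.1 ∨ z = w) : cq ∈ keySet ℓ Mh (D'.lev z.1) z.1 := by
  obtain ⟨hi1, hij, hji, hdown, hup⟩ := fin_data hc
  have hjk := hc.hj.2
  have hj1 := hc.hj.1
  have hu' : hq ((ℓ + 1) ^ cq.1) ((ℓ + 1) * Mh) cq.2 w.1 ≠ 0 := hu
  have hN1 : 1 ≤ (ℓ + 1) ^ cq.1 * ((ℓ + 1) * Mh) := Nat.one_le_iff_ne_zero.2 (by positivity)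
  have hNM : (ℓ + 1) ^ cq.1 * ((ℓ + 1) * Mh) = bigSide ℓ Mh cq.1 := by rw [bigSide_eq]; ring
  -- `N_j ≥ 4`, so that `⅝N_j + 1 ≤ N_j`
  have hN4 : (4 : ℝ) ≤ ((bigSide ℓ Mh cq.1 : ℕ) : ℝ) := by
    have h2 : 2 ^ (cq.1 + 1) ≤ (ℓ + 1) ^ (cq.1 + 1) := Nat.pow_le_pow_left (by omega) _
    have h4 : 4 ≤ 2 ^ (cq.1 + 1) :=
      calc 4 = 2 ^ 2 := by norm_num
        _ ≤ 2 ^ (cq.1 + 1) := Nat.pow_le_pow_right (by norm_num) (by omega)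
    have h : 4 ≤ bigSide ℓ Mh cq.1 := by
      unfold bigSide
      calc 4 = 1 * 4 := by ring
        _ ≤ Mh * (ℓ + 1) ^ (cq.1 + 1) := Nat.mul_le_mul hMh (h4.trans h2)
    exact_mod_cast h
  -- the cube image of `z` (the [3] (2.6) margin), before destructing `hzw`
  obtain ⟨b, hb⟩ := img_of_uX_ne_zero hℓ hP hMh cq hc hu hzw
  -- the coordinates of `z` and `w` differ by at most one
  have hdiff : ∀ ν, |((z.1 ν : ℤ) : ℝ) - ((w.1 ν : ℤ) : ℝ)| ≤ 1 := by
    intro ν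
    rw [← Int.cast_sub]
    rcases hzw with hzw | hzw
    · obtain ⟨i, hi | hi⟩ := mem_nbrs.1 hzw
      · have e : z.1 ν - w.1 ν = (Pi.single i (1 : ℤ) : Fin (d + 1) → ℤ) ν := by rw [hi]; simp
        rw [e]
        by_cases hν : ν = i
        · subst hν; simp
        · rw [Pi.single_eq_of_ne hν]; simp
      · have e : z.1 ν - w.1 ν = -(Pi.single i (1 : ℤ) : Fin (d + 1) → ℤ) ν := by rw [hi]; simp
        rw [e]
        by_cases hν : ν = i
        · subst hν; simp
        · rw [Pi.single_eq_of_ne hν]; simp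
    · rw [hzw]; simp
  -- (b) the candidate centres at `z`
  have hnear : cq.2 ∈ near (bigSide ℓ Mh cq.1) z.1 := by
    refine mem_near_of_abs_lt (one_le_bigSide hMh cq.1) fun ν => ?_
    have h := abs_lt_of_hq_ne_zero hN1 hu' ν
    rw [hNM] at h
    have h1 : |pos z.1 ν - pos w.1 ν| ≤ 1 := by
      have e : pos z.1 ν - pos w.1 ν = ((z.1 ν : ℤ) : ℝ) - ((w.1 ν : ℤ) : ℝ) := by simp only [pos]; ring
      rw [e]; exact hdiff ν
    have h2 := abs_sub_le (pos z.1 ν) (pos w.1 ν) (((bigSide ℓ Mh cq.1 : ℕ) : ℝ) * cq.2 ν)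
    linarith
  -- (a) the level window at `z`
  have hwin := window_of_active (D := D') hℓ hR hP hMh hi1 hij hjk hc.hq hc.hact hdown hup b
  have hbz : (B6Eq238TwoLevelBox.emb ℓ (fin D' cq.1 cq.2) (MhP ℓ Mh cq.1 (fin D' cq.1 cq.2)) (Pj ℓ k P cq.1) cq.2
      (one_le_Pj hP cq.1) hc.hq b).1 = z.1 := by
    have h1 : (embC D' hP cq hc b).1 = z.1 := by rw [hb]; unfold castP; exact boxCast_symm_apply_val _ _
    exact h1
  rw [hbz] at hwin
  exact mem_keySet (by omega) (by omega) hnear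

variable {D : TDomains d ℓ Mh k P R}

/-- the chart translations commute with the unit translations. [cite: Balaban1984PropagatorsII, p.229, dictionary] -/
theorem σc_symm_tshift (j : ℕ) (q t : Fin (d + 1) → ℤ) (z : ↥(boxDom (N0 ℓ Mh k P))) :
    (σc ℓ Mh k P j q).symm (tshift (N0 ℓ Mh k P) t z) = tshift (N0 ℓ Mh k P) t ((σc ℓ Mh k P j q).symm z) := by
  unfold σc
  exact tshift_symm_tshift _ _ _ _

/-- the central profile of a torus cube, read in its chart, vanishes at the wall sites. [cite: Balaban1984PropagatorsII, (2.36) p.229, dictionary] -/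
theorem uX_central_eq_zero (hMh : 1 ≤ Mh) (hP4 : ∀ μ, 4 ≤ P μ) {cq : ℕ × (Fin (d + 1) → ℤ)} (hc : CubeDataT D cq)
    {w : ↥(boxDom (N0 ℓ Mh k P))} (hw : ¬ Interior (N0 ℓ Mh k P) w) :
    uX (ℓ := ℓ) (Mh := Mh) (k := k) (P := P) (cq.1, qc ℓ k cq.1 cq.2) w = 0 := by
  by_contra h
  exact hw (interior_of_uFun_ne_zero hMh hP4 hc.hj.2 cq.2 w h)

/-- **THE ROW SUPPORT OF A BOND TERM ON THE TORUS**: if the transported term `σ(h_□G′(□)v_□)σ⁻¹λ` of the torus cube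
`□ = (j, q)` has different values at `x` and at its periodic neighbour `x + e_μ`, then `(j, Qmap_x(q))` is one of the
`≤ 3·2^{d+1}` keys at `x` (in the chart: `h_□ ≠ 0` at `σ⁻¹x` or at its lattice neighbour `σ⁻¹x + e_μ` — a wrap inside the
chart would put both on the walls, where `h_□ = 0`). [cite: Balaban1984PropagatorsII, p.229 (cover of finite overlap), (2.36)–(2.37) p.229] -/
theorem mem_keySet_of_dT_aT_ne_zero {a c : ℕ → ℝ} (hℓ : 1 ≤ ℓ) (hR : 2 * (ℓ + 1) ≤ R) (hP : ∀ μ, 1 ≤ P μ)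
    (hP4 : ∀ μ, 4 ≤ P μ) (hMh : 1 ≤ Mh) (cq : ℕ × (Fin (d + 1) → ℤ)) (hc : CubeDataT D cq)
    (v : ↥(boxDom (N0 ℓ Mh k P)) → ℝ) (μ : Fin (d + 1)) {x : ↥(boxDom (N0 ℓ Mh k P))}
    (hz : (aT D a c hP hP4 cq hc *ᵥ v) (tshift (N0 ℓ Mh k P) (unitVec μ) x) - (aT D a c hP hP4 cq hc *ᵥ v) x ≠ 0) :
    (cq.1, Qmap ℓ Mh k P cq.1 x.1 cq.2) ∈ keySet ℓ Mh (D.lev x.1) x.1 := by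
  unfold aT at hz
  rw [reindex_mulVec_apply, reindex_mulVec_apply, σc_symm_tshift] at hz
  have hor : uX (ℓ := ℓ) (Mh := Mh) (k := k) (P := P) (cq.1, qc ℓ k cq.1 cq.2) ((σc ℓ Mh k P cq.1 cq.2).symm x) ≠ 0
      ∨ uX (ℓ := ℓ) (Mh := Mh) (k := k) (P := P) (cq.1, qc ℓ k cq.1 cq.2)
          (tshift (N0 ℓ Mh k P) (unitVec μ) ((σc ℓ Mh k P cq.1 cq.2).symm x)) ≠ 0 := by
    by_contra h
    push Not at h
    apply hz
    rw [aX_mulVec_apply, aX_mulVec_apply, h.1, h.2, zero_mul, zero_mul, sub_zero]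
  have hkey : (cq.1, qc ℓ k cq.1 cq.2)
      ∈ keySet ℓ Mh ((Dc D cq.1 cq.2).lev ((σc ℓ Mh k P cq.1 cq.2).symm x).1) ((σc ℓ Mh k P cq.1 cq.2).symm x).1 := by
    rcases hor with h | h
    · exact mem_keySet_of_uX_ne_zero_nbr hℓ hR hP hMh _ (cubeData_chart hP4 hc) h (Or.inr rfl)
    · have hint : Interior (N0 ℓ Mh k P) (tshift (N0 ℓ Mh k P) (unitVec μ) ((σc ℓ Mh k P cq.1 cq.2).symm x)) :=
        interior_of_uFun_ne_zero hMh hP4 hc.hj.2 cq.2 _ h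
      have hxe : ((σc ℓ Mh k P cq.1 cq.2).symm x).1 + Pi.single μ 1 ∈ boxDom (N0 ℓ Mh k P) := by
        by_contra hne
        exact not_interior_tshift_of_not_mem hne hint
      have hval : (tshift (N0 ℓ Mh k P) (unitVec μ) ((σc ℓ Mh k P cq.1 cq.2).symm x)).1
          = ((σc ℓ Mh k P cq.1 cq.2).symm x).1 + Pi.single μ 1 := tshift_val_of_mem hxe
      exact mem_keySet_of_uX_ne_zero_nbr hℓ hR hP hMh _ (cubeData_chart hP4 hc) h
        (Or.inl (mem_nbrs.2 ⟨μ, Or.inr (by rw [hval, add_sub_cancel_right])⟩))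
  rw [Dc_lev_symm] at hkey
  exact mem_keySet_chart hMh hc.hj.2 hkey

end Support

/-! ## §4 The majorant of `∂G′₀` on the torus blocks `𝔅` -/

section DGMajorant
set_option maxHeartbeats 400000 in
/-- **THE MAJORANT OF `∂G′₀` ON `𝔅` FOR THE GENUINE `k`-LEVEL OPERATOR ON THE TORUS**: there are `δ₃, A > 0` (functions of
`d`, `ℓ`, windows) such that for every `k`, `M_h ≥ 3`, `R ≥ 2L`, torus size (`P_μ ≥ 4`), nested family `D` of domains of
the torus, weights in the windows and axis `μ`, `|(G′₀λ)(x + e_μ) − (G′₀λ)(x)| ≤ A·L^{j}·e^{−(δ₃/(d+1))·d_T(y,y′)}|λ|` for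
`x ∈ B^j(y)`, `supp λ ⊂ B^{j′}(y′)` (`x + e_μ` on the torus) — per transported term, in its chart, the box lineage's product
rule with (2.43)₁ at `x′ + e_μ` and (2.43)₂ at `x′`, `|∂h_□| ≤ (d+1)D₁/L^{j_□}`, the lattice-unit factors, the support
distance read from `d_{chart} ≥ d_T`, and at most `3·2^{d+1}` terms per bond. [cite: Balaban1984PropagatorsII, (2.66)–(2.67) p.234 (the ∇^ηG′₀ factor «O(1)L^jη»), (2.43) p.230] -/
theorem dT_gZeroT_majorant (d ℓ : ℕ) (hℓ : 1 ≤ ℓ) (aminus aplus a2minus a2plus : ℝ) (ha : 0 < aminus)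
    (ha2 : 0 < a2minus) :
    ∃ δ₃ A : ℝ, 0 < δ₃ ∧ 0 < A ∧ ∀ (k Mh R : ℕ), 3 ≤ Mh → 2 * (ℓ + 1) ≤ R →
      ∀ (P : Fin (d + 1) → ℕ) (hP : ∀ μ, 1 ≤ P μ) (hP4 : ∀ μ, 4 ≤ P μ) (D : TDomains d ℓ Mh k P R) (a c : ℕ → ℝ),
        (∀ i, 1 ≤ i → aminus ≤ a i ∧ a i ≤ aplus) → (∀ i, 1 ≤ i → a2minus ≤ c i ∧ c i ≤ a2plus) →
        ∀ μ : Fin (d + 1),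
        HasMajorant (g := geomT D) (blkOf D.toDomains)
          (Matrix.toLin' (dT (N0 ℓ Mh k P) μ * gZeroT D a c hP hP4))
          (fun y y' => A * ((ℓ : ℝ) + 1) ^ y.1.1 * Real.exp (-(δ₃ / (d + 1) * (geomT D).dist y y'))) := by
  obtain ⟨δ'', c', hδ'', hc', h243⟩ := ineq243_twoLevel_roww d ℓ hℓ aminus aplus 0 a2minus a2plus ha ha2
  obtain ⟨δd, cd, hδd, hcd, h243d⟩ := ineq243_twoLevel_deriv_wsum d ℓ hℓ aminus aplus 0 a2minus a2plus ha ha2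
  have hD1 := D1_nonneg contDiff_hprof hasCompactSupport_hprof
  set δ₃ : ℝ := min δ'' δd with hδ₃
  have hδ₃pos : 0 < δ₃ := lt_min hδ'' hδd
  set Q : ℝ := (d + 1) * D1 hprof * (c' * (Real.exp δ'' * Real.exp δ'')) + cd * Real.exp δd with hQ
  have hQ0 : 0 ≤ Q := by positivity
  refine ⟨δ₃, 3 * 2 ^ (d + 1) * Q + 1, hδ₃pos, by positivity, ?_⟩
  intro k Mh R hMh hR P hP hP4 D a c haw hcw μ y' lam B hlam x
  have hMh1 : 1 ≤ Mh := le_trans (by norm_num) hMh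
  have hL1 : (1 : ℝ) ≤ (ℓ : ℝ) + 1 := by linarith [(Nat.cast_nonneg ℓ : (0 : ℝ) ≤ ℓ)]
  have hB0 : 0 ≤ B := hlam.nonneg
  rw [Matrix.toLin'_apply, ← Matrix.mulVec_mulVec, dT_mulVec]
  set dist0 : ℝ := (((bondT D).dist (blkOf D.toDomains x) y' : ℕ) : ℝ) with hdist0
  have hgeom : (geomT D).dist (blkOf D.toDomains x) y' = dist0 := rfl
  have hlevx : (blkOf D.toDomains x).1.1 = D.lev x.1 := rfl
  have hdist0nn : 0 ≤ dist0 := by positivity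
  -- THE BOX LINEAGE'S BOUND OF ONE BOND TERM, for ANY family on the fundamental box (file `B6Prop22DerivMultiLevelBox`'s
  -- per-cube argument): `x′`, `x′ + e_μ` both in the box
  have hbox : ∀ (D' : Domains d ℓ Mh k P R) (y'' : ↥(bset D')) (lam' : ↥(boxDom (N0 ℓ Mh k P)) → ℝ),
      BlockSupp (g := geom D') (blkOf D') lam' y'' B →
      ∀ (x' : ↥(boxDom (N0 ℓ Mh k P))) (hxe : x'.1 + Pi.single μ 1 ∈ boxDom (N0 ℓ Mh k P))
        (cq : ℕ × (Fin (d + 1) → ℤ)) (hc : CubeData D' cq),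
        |(aX D' a c hP cq hc *ᵥ lam') ⟨x'.1 + Pi.single μ 1, hxe⟩ - (aX D' a c hP cq hc *ᵥ lam') x'|
          ≤ ((ℓ : ℝ) + 1) ^ D'.lev x'.1
            * (Q * Real.exp (-(δ₃ / (d + 1) * (((bond D').dist (blkOf D' x') y'' : ℕ) : ℝ))) * B) := by
    intro D' y'' lam' hlam' x' hxe cq hc
    have hlamB : ∀ w, |lam' w| ≤ B := fun w => BlockSupp.abs_le hlam' w
    set dist1 : ℝ := (((bond D').dist (blkOf D' x') y'' : ℕ) : ℝ) with hdist1
    have hdist1nn : 0 ≤ dist1 := by positivity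
    set xe : ↥(boxDom (N0 ℓ Mh k P)) := ⟨x'.1 + Pi.single μ 1, hxe⟩ with hxedef
    have hxe1 : xe.1 = x'.1 + Pi.single μ 1 := rfl
    set E1 : ℝ := ((ℓ : ℝ) + 1) ^ D'.lev x'.1 * (Q * Real.exp (-(δ₃ / (d + 1) * dist1)) * B) with hE1
    have hE10 : 0 ≤ E1 := by positivity
    obtain ⟨hi1, hij, hji, -, -⟩ := fin_data hc
    have hjk := hc.hj.2
    by_cases h0 : uX (ℓ := ℓ) (Mh := Mh) (k := k) (P := P) cq x' = 0
        ∧ uX (ℓ := ℓ) (Mh := Mh) (k := k) (P := P) cq xe = 0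
    · rw [aX_mulVec_apply, aX_mulVec_apply, h0.1, h0.2, zero_mul, zero_mul, sub_zero, abs_zero]; exact hE10
    have hor : uX (ℓ := ℓ) (Mh := Mh) (k := k) (P := P) cq x' ≠ 0
        ∨ uX (ℓ := ℓ) (Mh := Mh) (k := k) (P := P) cq xe ≠ 0 := by
      by_contra h'; push Not at h'; exact h0 ⟨by tauto, by tauto⟩
    -- both ends of the bond lie in the cube image
    have hxe_nb : xe.1 ∈ nbrs x'.1 := mem_nbrs.2 ⟨μ, Or.inl hxe1⟩
    have hx_nb : x'.1 ∈ nbrs xe.1 := mem_nbrs.2 ⟨μ, Or.inr (by rw [hxe1, add_sub_cancel_right])⟩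
    obtain ⟨y, hy⟩ : ∃ y, embC D' hP cq hc y = (castP (ℓ := ℓ) (Mh := Mh) (P := P) hij hjk).symm x' := by
      rcases hor with h | h
      · exact img_of_uX_ne_zero hℓ hP hMh1 cq hc h (Or.inr rfl)
      · exact img_of_uX_ne_zero hℓ hP hMh1 cq hc h (Or.inl hx_nb)
    obtain ⟨ye, hye⟩ : ∃ ye, embC D' hP cq hc ye = (castP (ℓ := ℓ) (Mh := Mh) (P := P) hij hjk).symm xe := by
      rcases hor with h | h
      · exact img_of_uX_ne_zero hℓ hP hMh1 cq hc h (Or.inl hxe_nb)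
      · exact img_of_uX_ne_zero hℓ hP hMh1 cq hc h (Or.inr rfl)
    have hzval : ∀ w : ↥(boxDom (N0 ℓ Mh k P)), ((castP (ℓ := ℓ) (Mh := Mh) (P := P) hij hjk).symm w).1 = w.1 :=
      fun w => by unfold castP; exact boxCast_symm_apply_val _ _
    have hyx : (embC D' hP cq hc y).1 = x'.1 := by rw [hy, hzval]
    have hyexe : (embC D' hP cq hc ye).1 = xe.1 := by rw [hye, hzval]
    have hyey : ye.1 = y.1 + Pi.single μ 1 := by
      have h1 : (embC D' hP cq hc ye).1 - (embC D' hP cq hc y).1 = ye.1 - y.1 := by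
        unfold embC; exact emb_sub_emb _ hc.hq ye y
      rw [hyexe, hyx, hxe1, add_sub_cancel_left, eq_comm, sub_eq_iff_eq_add'] at h1
      exact h1
    have hxin : InCube ℓ Mh k P cq.1 cq.2 x'.1 := by
      rw [← hzval x']
      exact (inCube_iff_exists_emb (Mh := Mh) hP hij hc.hq _).2 ⟨y, hy⟩
    have hlevwin := lev_window_of_inCube hℓ hR hP hMh1 hc x'.2 hxin
    have hMh' : 1 ≤ MhP ℓ Mh cq.1 (fin D' cq.1 cq.2) := one_le_MhP hMh1 _ _
    have hcM' : ∀ ν, 1 ≤ cubeM' (MhP ℓ Mh cq.1 (fin D' cq.1 cq.2)) (Pj ℓ k P cq.1) cq.2 ν := fun ν =>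
      Nat.one_le_iff_ne_zero.2 (Nat.mul_ne_zero_iff.2
        ⟨by omega, by have := (one_le_cubeW (one_le_Pj hP cq.1) hc.hq ν).1; omega⟩)
    have hn : (0 : ℝ) < (((ℓ + 1) ^ fin D' cq.1 cq.2 : ℕ) : ℝ) := by positivity
    have hn1 : (1 : ℝ) ≤ (((ℓ + 1) ^ fin D' cq.1 cq.2 : ℕ) : ℝ) := by
      exact_mod_cast Nat.one_le_pow _ _ (by omega)
    have hncast : (((ℓ + 1) ^ fin D' cq.1 cq.2 : ℕ) : ℝ) = ((ℓ : ℝ) + 1) ^ fin D' cq.1 cq.2 := by push_cast; ring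
    set Dd : ℝ := (((ℓ + 1) ^ fin D' cq.1 cq.2 : ℕ) : ℝ) * (dist1 / (d + 1) - 1) with hDd
    -- the vector `u = res(v_□λ′ ∘ cast)` on the cube, its bound and its support distance from `y`
    have hF : ∀ b, |(res (embC D' hP cq hc) *ᵥ ((Matrix.diagonal (vX D' cq) *ᵥ lam') ∘ castP (fin_data hc).2.1 hc.hj.2)) b|
        ≤ B := by
      intro b
      rw [res_mulVec, Function.comp_apply, Matrix.mulVec_diagonal, abs_mul]
      calc |vX D' cq _| * |lam' _| ≤ 1 * B := mul_le_mul (abs_vFun_le_one _ _ _) (hlamB _) (abs_nonneg _) zero_le_one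
        _ = B := one_mul _
    have hD : ∀ b, (res (embC D' hP cq hc) *ᵥ ((Matrix.diagonal (vX D' cq) *ᵥ lam') ∘ castP (fin_data hc).2.1 hc.hj.2)) b
        ≠ 0 → Dd ≤ supNorm (y.1 - b.1) := by
      intro b hb
      rw [res_mulVec, Function.comp_apply, Matrix.mulVec_diagonal] at hb
      set x'' : ↥(boxDom (N0 ℓ Mh k P)) := castP (fin_data hc).2.1 hc.hj.2 (embC D' hP cq hc b) with hx''
      have hμx : lam' x'' ≠ 0 := fun h0 => hb (by rw [h0, mul_zero])
      have hx''val : x''.1 = (embC D' hP cq hc b).1 := by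
        rw [hx'']; unfold castP; exact boxCast_apply_val _ _
      have hx''in : InCube ℓ Mh k P cq.1 cq.2 x''.1 := by
        rw [hx''val]
        exact (inCube_iff_exists_emb (Mh := Mh) hP hij hc.hq _).2 ⟨b, rfl⟩
      have hblk : blkOf D' x'' = y'' := by
        by_contra hne
        exact hμx (hlam'.off x'' hne)
      have h := Dd_le_supNorm hℓ hR hP hMh1 hc x' x'' hxin hx''in y'' hblk
      have hsub : x'.1 - x''.1 = y.1 - b.1 := by
        rw [hx''val, ← hyx]; unfold embC; exact emb_sub_emb _ hc.hq y b
      rw [hsub] at h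
      exact h
    have hD' : ∀ b, (res (embC D' hP cq hc) *ᵥ ((Matrix.diagonal (vX D' cq) *ᵥ lam') ∘ castP (fin_data hc).2.1 hc.hj.2)) b
        ≠ 0 → Dd - 1 ≤ supNorm (ye.1 - b.1) := by
      intro b hb
      have h1 := hD b hb
      have h2 := supNorm_sub_le_nbr (x' := b.1) hyey
      linarith
    -- (2.43)₁ at `x′ + e_μ` on the cube, in the decaying form
    have hrow : roww δ'' ((ℓ + 1) ^ fin D' cq.1 cq.2) (cG D' a c cq.1 (fin D' cq.1 cq.2) cq.2 hP hc.hq) ye ≤ c' :=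
      h243 (fin D' cq.1 cq.2) hi1 (a (fin D' cq.1 cq.2)) 0 (c (fin D' cq.1 cq.2)) (haw _ hi1).1 (haw _ hi1).2 le_rfl
        le_rfl (hcw _ hi1).1 (hcw _ hi1).2 _ hcM' _ ye
    have hval := mulVec_le_of_roww hδ''.le ((ℓ + 1) ^ fin D' cq.1 cq.2)
      (cG D' a c cq.1 (fin D' cq.1 cq.2) cq.2 hP hc.hq) ye hrow _ hF hD'
    have hval' : |(cG D' a c cq.1 (fin D' cq.1 cq.2) cq.2 hP hc.hq
          *ᵥ (res (embC D' hP cq hc) *ᵥ ((Matrix.diagonal (vX D' cq) *ᵥ lam') ∘ castP (fin_data hc).2.1 hc.hj.2))) ye|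
        ≤ c' * (Real.exp δ'' * Real.exp δ'') * Real.exp (-(δ₃ / (d + 1) * dist1)) * B := by
      refine hval.trans ?_
      have h1 : Real.exp (-(δ'' * (Dd - 1) / (((ℓ + 1) ^ fin D' cq.1 cq.2 : ℕ) : ℝ)))
          ≤ Real.exp δ'' * Real.exp δ'' * Real.exp (-(δ₃ / (d + 1) * dist1)) := by
        refine (exp_shift_le hδ''.le hn1).trans ?_
        rw [hDd, exp_Dd_eq hn d, mul_assoc]
        exact mul_le_mul_of_nonneg_left (mul_le_mul_of_nonneg_left
          (exp_rate_mono (min_le_left _ _) hdist1nn d) (Real.exp_pos _).le) (Real.exp_pos _).le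
      calc c' * Real.exp (-(δ'' * (Dd - 1) / (((ℓ + 1) ^ fin D' cq.1 cq.2 : ℕ) : ℝ))) * B
          ≤ c' * (Real.exp δ'' * Real.exp δ'' * Real.exp (-(δ₃ / (d + 1) * dist1))) * B :=
            mul_le_mul_of_nonneg_right (mul_le_mul_of_nonneg_left h1 hc'.le) hB0
        _ = c' * (Real.exp δ'' * Real.exp δ'') * Real.exp (-(δ₃ / (d + 1) * dist1)) * B := by ring
    -- (2.43)₂ at `x′` on the cube, in the decaying form
    have hwrow := h243d (fin D' cq.1 cq.2) hi1 (a (fin D' cq.1 cq.2)) 0 (c (fin D' cq.1 cq.2)) (haw _ hi1).1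
      (haw _ hi1).2 le_rfl le_rfl (hcw _ hi1).1 (hcw _ hi1).2 _ hcM'
      (lamLoc ℓ (MhP ℓ Mh cq.1 (fin D' cq.1 cq.2)) (Pj ℓ k P cq.1) cq.2 (one_le_Pj hP cq.1) hc.hq
        (LamG D' cq.1 (fin D' cq.1 cq.2))) μ y ye hyey
    have hder := sum_mul_le_of_wrow hn hB0
      (fun z => (((ℓ + 1) ^ fin D' cq.1 cq.2 : ℕ) : ℝ)
        * (cG D' a c cq.1 (fin D' cq.1 cq.2) cq.2 hP hc.hq ye z - cG D' a c cq.1 (fin D' cq.1 cq.2) cq.2 hP hc.hq y z))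
      (res (embC D' hP cq hc) *ᵥ ((Matrix.diagonal (vX D' cq) *ᵥ lam') ∘ castP (fin_data hc).2.1 hc.hj.2))
      (fun z => supNorm (y.1 - z.1)) hwrow hF hD hδd.le
    have hder' : |(((ℓ + 1) ^ fin D' cq.1 cq.2 : ℕ) : ℝ)
          * ((cG D' a c cq.1 (fin D' cq.1 cq.2) cq.2 hP hc.hq
              *ᵥ (res (embC D' hP cq hc) *ᵥ ((Matrix.diagonal (vX D' cq) *ᵥ lam') ∘ castP (fin_data hc).2.1 hc.hj.2))) ye
            - (cG D' a c cq.1 (fin D' cq.1 cq.2) cq.2 hP hc.hq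
              *ᵥ (res (embC D' hP cq hc) *ᵥ ((Matrix.diagonal (vX D' cq) *ᵥ lam') ∘ castP (fin_data hc).2.1 hc.hj.2))) y)|
        ≤ cd * Real.exp δd * Real.exp (-(δ₃ / (d + 1) * dist1)) * B := by
      have hsum : (((ℓ + 1) ^ fin D' cq.1 cq.2 : ℕ) : ℝ)
          * ((cG D' a c cq.1 (fin D' cq.1 cq.2) cq.2 hP hc.hq
              *ᵥ (res (embC D' hP cq hc) *ᵥ ((Matrix.diagonal (vX D' cq) *ᵥ lam') ∘ castP (fin_data hc).2.1 hc.hj.2))) ye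
            - (cG D' a c cq.1 (fin D' cq.1 cq.2) cq.2 hP hc.hq
              *ᵥ (res (embC D' hP cq hc) *ᵥ ((Matrix.diagonal (vX D' cq) *ᵥ lam') ∘ castP (fin_data hc).2.1 hc.hj.2))) y)
          = ∑ z, (((ℓ + 1) ^ fin D' cq.1 cq.2 : ℕ) : ℝ)
              * (cG D' a c cq.1 (fin D' cq.1 cq.2) cq.2 hP hc.hq ye z - cG D' a c cq.1 (fin D' cq.1 cq.2) cq.2 hP hc.hq y z)
              * (res (embC D' hP cq hc) *ᵥ ((Matrix.diagonal (vX D' cq) *ᵥ lam') ∘ castP (fin_data hc).2.1 hc.hj.2)) z := by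
        simp only [Matrix.mulVec, dotProduct]
        rw [← Finset.sum_sub_distrib, Finset.mul_sum]
        refine Finset.sum_congr rfl fun z _ => ?_
        ring
      rw [hsum]
      refine hder.trans ?_
      have h1 : Real.exp (-(δd * Dd / (((ℓ + 1) ^ fin D' cq.1 cq.2 : ℕ) : ℝ)))
          ≤ Real.exp δd * Real.exp (-(δ₃ / (d + 1) * dist1)) := by
        rw [hDd, exp_Dd_eq hn d]
        exact mul_le_mul_of_nonneg_left (exp_rate_mono (min_le_right _ _) hdist1nn d) (Real.exp_pos _).le
      calc cd * Real.exp (-(δd * Dd / (((ℓ + 1) ^ fin D' cq.1 cq.2 : ℕ) : ℝ))) * B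
          ≤ cd * (Real.exp δd * Real.exp (-(δ₃ / (d + 1) * dist1))) * B :=
            mul_le_mul_of_nonneg_right (mul_le_mul_of_nonneg_left h1 hcd.le) hB0
        _ = cd * Real.exp δd * Real.exp (-(δ₃ / (d + 1) * dist1)) * B := by ring
    -- `|h_□| ≤ 1`, `|∂h_□| ≤ (d+1)D₁/L^{j_□}`
    have huXx : |uX (ℓ := ℓ) (Mh := Mh) (k := k) (P := P) cq x'| ≤ 1 := abs_hq_le_one _ _ _ _
    have hNj1 : 1 ≤ (ℓ + 1) ^ cq.1 := Nat.one_le_pow _ _ (by omega)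
    have hM1 : 1 ≤ (ℓ + 1) * Mh := by nlinarith
    have hdu : |uX (ℓ := ℓ) (Mh := Mh) (k := k) (P := P) cq xe - uX (ℓ := ℓ) (Mh := Mh) (k := k) (P := P) cq x'|
        ≤ (d + 1) * D1 hprof / (((ℓ + 1) ^ cq.1 : ℕ) : ℝ) := by
      have h := abs_hq_sub_le (d := d) hNj1 hM1 cq.2 x'.1 xe.1
      have hs : supNorm (xe.1 - x'.1) ≤ 1 := by
        rw [hxe1, add_sub_cancel_left]; exact supNorm_single_le μ
      have hMr : (1 : ℝ) ≤ (((ℓ + 1) * Mh : ℕ) : ℝ) := by exact_mod_cast hM1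
      have hnj : (0 : ℝ) < (((ℓ + 1) ^ cq.1 : ℕ) : ℝ) := by positivity
      have hA0 : 0 ≤ (d + 1) * D1 hprof / (((ℓ + 1) * Mh : ℕ) : ℝ) := by positivity
      have h5 : (d + 1) * D1 hprof / (((ℓ + 1) * Mh : ℕ) : ℝ) * supNorm (xe.1 - x'.1) ≤ (d + 1) * D1 hprof :=
        calc (d + 1) * D1 hprof / (((ℓ + 1) * Mh : ℕ) : ℝ) * supNorm (xe.1 - x'.1)
            ≤ (d + 1) * D1 hprof / (((ℓ + 1) * Mh : ℕ) : ℝ) * 1 := mul_le_mul_of_nonneg_left hs hA0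
          _ = (d + 1) * D1 hprof / (((ℓ + 1) * Mh : ℕ) : ℝ) := mul_one _
          _ ≤ (d + 1) * D1 hprof := div_le_self (by positivity) hMr
      exact h.trans (div_le_div_of_nonneg_right h5 hnj.le)
    -- the lattice-unit factors `n²/L^{j_□} ≤ n ≤ L^{lev x′}`
    have hnle : (((ℓ + 1) ^ fin D' cq.1 cq.2 : ℕ) : ℝ) ≤ ((ℓ : ℝ) + 1) ^ D'.lev x'.1 := by
      rw [hncast]; exact pow_le_pow_right₀ hL1 hlevwin.1
    have hsq : (((ℓ + 1) ^ fin D' cq.1 cq.2 : ℕ) : ℝ) * (((ℓ + 1) ^ fin D' cq.1 cq.2 : ℕ) : ℝ)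
        / (((ℓ + 1) ^ cq.1 : ℕ) : ℝ) ≤ ((ℓ : ℝ) + 1) ^ D'.lev x'.1 := by
      have hnj : (0 : ℝ) < (((ℓ + 1) ^ cq.1 : ℕ) : ℝ) := by positivity
      have h2 : (((ℓ + 1) ^ cq.1 : ℕ) : ℝ) = ((ℓ : ℝ) + 1) ^ cq.1 := by push_cast; ring
      rw [div_le_iff₀ hnj, hncast, ← pow_add, h2, ← pow_add]
      exact pow_le_pow_right₀ hL1 (by omega)
    -- assembling the product rule
    rw [aX_mulVec_apply, aX_mulVec_apply, gX_row_img hP cq hc _ hye, gX_row_img hP cq hc _ hy]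
    obtain ⟨gye, hgye⟩ : ∃ t : ℝ, t = (cG D' a c cq.1 (fin D' cq.1 cq.2) cq.2 hP hc.hq
        *ᵥ (res (embC D' hP cq hc) *ᵥ ((Matrix.diagonal (vX D' cq) *ᵥ lam') ∘ castP (fin_data hc).2.1 hc.hj.2))) ye :=
      ⟨_, rfl⟩
    obtain ⟨gy, hgy⟩ : ∃ t : ℝ, t = (cG D' a c cq.1 (fin D' cq.1 cq.2) cq.2 hP hc.hq
        *ᵥ (res (embC D' hP cq hc) *ᵥ ((Matrix.diagonal (vX D' cq) *ᵥ lam') ∘ castP (fin_data hc).2.1 hc.hj.2))) y :=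
      ⟨_, rfl⟩
    rw [← hgye] at hval' hder' ⊢
    rw [← hgy] at hder' ⊢
    obtain ⟨nn, hnn⟩ : ∃ t : ℝ, t = (((ℓ + 1) ^ fin D' cq.1 cq.2 : ℕ) : ℝ) := ⟨_, rfl⟩
    have hn2eq : ((((ℓ : ℝ) + 1)) ^ fin D' cq.1 cq.2) ^ 2 = nn * nn := by rw [hnn, hncast]; ring
    rw [← hnn] at hder' hnle hsq
    rw [hn2eq]
    have hnn0 : 0 ≤ nn := by rw [hnn]; positivity
    have hsplit : uX (ℓ := ℓ) (Mh := Mh) (k := k) (P := P) cq xe * (nn * nn * gye)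
          - uX (ℓ := ℓ) (Mh := Mh) (k := k) (P := P) cq x' * (nn * nn * gy)
        = (uX (ℓ := ℓ) (Mh := Mh) (k := k) (P := P) cq xe - uX (ℓ := ℓ) (Mh := Mh) (k := k) (P := P) cq x')
            * (nn * nn * gye)
          + uX (ℓ := ℓ) (Mh := Mh) (k := k) (P := P) cq x' * (nn * (nn * (gye - gy))) := by
      ring
    rw [hsplit]
    have hA1 : |(uX (ℓ := ℓ) (Mh := Mh) (k := k) (P := P) cq xe - uX (ℓ := ℓ) (Mh := Mh) (k := k) (P := P) cq x')
          * (nn * nn * gye)|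
        ≤ ((ℓ : ℝ) + 1) ^ D'.lev x'.1
            * ((d + 1) * D1 hprof * (c' * (Real.exp δ'' * Real.exp δ'')) * Real.exp (-(δ₃ / (d + 1) * dist1)) * B) := by
      rw [abs_mul, abs_mul, abs_of_nonneg (mul_nonneg hnn0 hnn0)]
      have hdu0 : 0 ≤ (d + 1) * D1 hprof / (((ℓ + 1) ^ cq.1 : ℕ) : ℝ) := by positivity
      calc |uX cq xe - uX cq x'| * (nn * nn * |gye|)
          ≤ ((d + 1) * D1 hprof / (((ℓ + 1) ^ cq.1 : ℕ) : ℝ))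
              * (nn * nn * (c' * (Real.exp δ'' * Real.exp δ'') * Real.exp (-(δ₃ / (d + 1) * dist1)) * B)) :=
            mul_le_mul hdu (mul_le_mul_of_nonneg_left hval' (mul_nonneg hnn0 hnn0)) (by positivity) hdu0
        _ = (nn * nn / (((ℓ + 1) ^ cq.1 : ℕ) : ℝ))
              * ((d + 1) * D1 hprof * (c' * (Real.exp δ'' * Real.exp δ'')) * Real.exp (-(δ₃ / (d + 1) * dist1)) * B) := by
            ring
        _ ≤ ((ℓ : ℝ) + 1) ^ D'.lev x'.1
              * ((d + 1) * D1 hprof * (c' * (Real.exp δ'' * Real.exp δ'')) * Real.exp (-(δ₃ / (d + 1) * dist1)) * B) :=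
            mul_le_mul_of_nonneg_right hsq (by positivity)
    have hA2 : |uX (ℓ := ℓ) (Mh := Mh) (k := k) (P := P) cq x' * (nn * (nn * (gye - gy)))|
        ≤ ((ℓ : ℝ) + 1) ^ D'.lev x'.1 * (cd * Real.exp δd * Real.exp (-(δ₃ / (d + 1) * dist1)) * B) := by
      rw [abs_mul, abs_mul, abs_of_nonneg hnn0]
      calc |uX cq x'| * (nn * |nn * (gye - gy)|)
          ≤ 1 * (((ℓ : ℝ) + 1) ^ D'.lev x'.1 * (cd * Real.exp δd * Real.exp (-(δ₃ / (d + 1) * dist1)) * B)) :=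
            mul_le_mul huXx (mul_le_mul hnle hder' (abs_nonneg _) (by positivity)) (by positivity) zero_le_one
        _ = ((ℓ : ℝ) + 1) ^ D'.lev x'.1 * (cd * Real.exp δd * Real.exp (-(δ₃ / (d + 1) * dist1)) * B) := one_mul _
    refine (abs_add_le _ _).trans ?_
    rw [hE1, hQ]
    have := add_le_add hA1 hA2
    refine this.trans (le_of_eq ?_)
    ring
  -- the bound of one TORUS bond term: the box bound in its chart (or zero at a wrap inside the chart)
  set E : ℝ := ((ℓ : ℝ) + 1) ^ D.lev x.1 * (Q * Real.exp (-(δ₃ / (d + 1) * dist0)) * B) with hE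
  have hE0 : 0 ≤ E := by positivity
  have hterm : ∀ (cq : ℕ × (Fin (d + 1) → ℤ)) (hc : CubeDataT D cq),
      |(aT D a c hP hP4 cq hc *ᵥ lam) (tshift (N0 ℓ Mh k P) (unitVec μ) x) - (aT D a c hP hP4 cq hc *ᵥ lam) x| ≤ E := by
    intro cq hc
    unfold aT
    rw [reindex_mulVec_apply, reindex_mulVec_apply, σc_symm_tshift]
    by_cases hxe : ((σc ℓ Mh k P cq.1 cq.2).symm x).1 + Pi.single μ 1 ∈ boxDom (N0 ℓ Mh k P)
    swap
    · -- a wrap inside the chart: both rows are wall rows of the central cube term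
      rw [aX_mulVec_apply, aX_mulVec_apply, uX_central_eq_zero hMh1 hP4 hc (not_interior_of_not_mem hxe),
        uX_central_eq_zero hMh1 hP4 hc (not_interior_tshift_of_not_mem hxe), zero_mul, zero_mul, sub_zero, abs_zero]
      exact hE0
    have hxeq : tshift (N0 ℓ Mh k P) (unitVec μ) ((σc ℓ Mh k P cq.1 cq.2).symm x)
        = ⟨((σc ℓ Mh k P cq.1 cq.2).symm x).1 + Pi.single μ 1, hxe⟩ := Subtype.ext (tshift_val_of_mem hxe)
    rw [hxeq]
    obtain ⟨b, hb⟩ := blkMap_surjective (D := D) hMh1 hP (svec ℓ k cq.1 cq.2) y'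
    have hμ' : BlockSupp (g := geom (Dc D cq.1 cq.2)) (blkOf (Dc D cq.1 cq.2)) (lam ∘ σc ℓ Mh k P cq.1 cq.2) b B :=
      blockSupp_chart hMh1 hP (svec ℓ k cq.1 cq.2) hlam hb
    have h := hbox (Dc D cq.1 cq.2) b (lam ∘ σc ℓ Mh k P cq.1 cq.2) hμ' ((σc ℓ Mh k P cq.1 cq.2).symm x) hxe
      (cq.1, qc ℓ k cq.1 cq.2) (cubeData_chart hP4 hc)
    rw [Dc_lev_symm] at h
    refine h.trans ?_
    have hd : dist0 ≤ (((bond (Dc D cq.1 cq.2)).dist (blkOf (Dc D cq.1 cq.2) ((σc ℓ Mh k P cq.1 cq.2).symm x)) b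
        : ℕ) : ℝ) := by
      rw [hdist0, ← hb]
      exact_mod_cast distT_blkOf_le_chart hMh1 hP (svec ℓ k cq.1 cq.2) x b
    rw [hE]
    have hexp : Real.exp (-(δ₃ / (d + 1) * (((bond (Dc D cq.1 cq.2)).dist
          (blkOf (Dc D cq.1 cq.2) ((σc ℓ Mh k P cq.1 cq.2).symm x)) b : ℕ) : ℝ)))
        ≤ Real.exp (-(δ₃ / (d + 1) * dist0)) := by
      rw [Real.exp_le_exp, neg_le_neg_iff]
      exact mul_le_mul_of_nonneg_left hd (by positivity)
    exact mul_le_mul_of_nonneg_left (mul_le_mul_of_nonneg_right (mul_le_mul_of_nonneg_left hexp hQ0) hB0)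
      (by positivity)
  -- summing over the cover: at most `3·2^{d+1}` terms have a non-zero difference at the bond of `x`
  unfold gZeroT
  rw [Matrix.sum_mulVec, Finset.sum_apply, Finset.sum_apply, ← Finset.sum_sub_distrib, Finset.attach_eq_univ]
  refine (Finset.abs_sum_le_sum_abs _ _).trans ?_
  have key := sum_le_card_mul
    (fun cq : {cq // cq ∈ cubeSetT D} =>
      |(aT D a c hP hP4 cq.1 (cubeDataT_of_mem cq.2) *ᵥ lam) (tshift (N0 ℓ Mh k P) (unitVec μ) x)
        - (aT D a c hP hP4 cq.1 (cubeDataT_of_mem cq.2) *ᵥ lam) x|)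
    (fun cq => (cq.1.1, Qmap ℓ Mh k P cq.1.1 x.1 cq.1.2)) (keyT_injective D x.1) (keySet ℓ Mh (D.lev x.1) x.1)
    (fun cq hq0 => mem_keySet_of_dT_aT_ne_zero hℓ hR hP hP4 hMh1 cq.1 (cubeDataT_of_mem cq.2) lam μ
      (fun h0 => hq0 (by rw [h0, abs_zero])))
    hE0 (fun cq => hterm cq.1 (cubeDataT_of_mem cq.2))
  refine key.trans ?_
  have hcard : ((keySet ℓ Mh (D.lev x.1) x.1).card : ℝ) ≤ 3 * 2 ^ (d + 1) := by
    exact_mod_cast card_keySet_le _ _ _ _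
  dsimp only
  rw [hgeom, hlevx]
  have hrest : 0 ≤ ((ℓ : ℝ) + 1) ^ D.lev x.1 * Real.exp (-(δ₃ / (d + 1) * dist0)) * B := by positivity
  calc ((keySet ℓ Mh (D.lev x.1) x.1).card : ℝ) * E ≤ 3 * 2 ^ (d + 1) * E := mul_le_mul_of_nonneg_right hcard hE0
    _ = 3 * 2 ^ (d + 1) * Q * (((ℓ : ℝ) + 1) ^ D.lev x.1 * Real.exp (-(δ₃ / (d + 1) * dist0)) * B) := by
        rw [hE]; ring
    _ ≤ (3 * 2 ^ (d + 1) * Q + 1) * (((ℓ : ℝ) + 1) ^ D.lev x.1 * Real.exp (-(δ₃ / (d + 1) * dist0)) * B) :=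
        mul_le_mul_of_nonneg_right (by linarith) hrest
    _ = (3 * 2 ^ (d + 1) * Q + 1) * ((ℓ : ℝ) + 1) ^ D.lev x.1 * Real.exp (-(δ₃ / (d + 1) * dist0)) * B := by ring

end DGMajorant

/-! ## §5 Proposition 2.2, second entry, for the genuine `k`-level operator on the torus -/

section Prop22

variable {ℓ Mh k R : ℕ} {P : Fin (d + 1) → ℕ}

/-- **THE DIFFERENTIATED FIXED POINT `∂G′ = ∂G′₀ + (∂G′)R`** of (2.38)/(2.50) for the genuine operator on the torus, as
linear maps. [cite: Balaban1984PropagatorsII, (2.38) p.229, (2.50) p.232, (2.66) p.234] -/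
theorem fixedPoint_dT_gmlT (D : TDomains d ℓ Mh k P R) {a c : ℕ → ℝ} (hℓ : 1 ≤ ℓ) (hR : 2 * (ℓ + 1) ≤ R)
    (hP : ∀ μ, 1 ≤ P μ) (hP4 : ∀ μ, 4 ≤ P μ) (hMh : 1 ≤ Mh) (ha : ∀ i, 1 ≤ i → 0 < a i)
    (hcpos : ∀ i, 1 ≤ i → 0 < c i) (hac : ∀ i, 1 ≤ i → a (i + 1) = aNext ℓ (a i) (c i)) (μ : Fin (d + 1)) :
    Matrix.toLin' (dT (N0 ℓ Mh k P) μ * gmlT (N0 ℓ Mh k P) ℓ k D.lev a)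
      = Matrix.toLin' (dT (N0 ℓ Mh k P) μ * gZeroT D a c hP hP4)
        + Matrix.toLin' (dT (N0 ℓ Mh k P) μ * gmlT (N0 ℓ Mh k P) ℓ k D.lev a)
          * Matrix.toLin' (rT D a c hP hP4) := by
  have h238 := eq238_multiLevelTorus (D := D) (a := a) (c := c) hℓ hR hP hP4 hMh ha hcpos hac
  have hGE : gmlT (N0 ℓ Mh k P) ℓ k D.lev a * mlOpT (N0 ℓ Mh k P) ℓ k D.lev a = 1 :=
    gmlT_mul_mlOpT_pos (one_le_N0 hMh hP) D.one_le_lev D.lev_le ha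
  have hmat : gmlT (N0 ℓ Mh k P) ℓ k D.lev a
      = gZeroT D a c hP hP4 + gmlT (N0 ℓ Mh k P) ℓ k D.lev a * rT D a c hP hP4 := by
    have h := congrArg (fun T => gmlT (N0 ℓ Mh k P) ℓ k D.lev a * T) h238
    rw [← Matrix.mul_assoc, hGE, Matrix.one_mul, Matrix.mul_sub, Matrix.mul_one] at h
    rw [h]; abel
  have hmat' : dT (N0 ℓ Mh k P) μ * gmlT (N0 ℓ Mh k P) ℓ k D.lev a
      = dT (N0 ℓ Mh k P) μ * gZeroT D a c hP hP4
        + dT (N0 ℓ Mh k P) μ * gmlT (N0 ℓ Mh k P) ℓ k D.lev a * rT D a c hP hP4 := by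
    conv_lhs => rw [hmat]
    rw [Matrix.mul_add, Matrix.mul_assoc]
  conv_lhs => rw [hmat']
  rw [map_add, Module.End.mul_eq_comp, ← Matrix.toLin'_mul]

/-- **[B6] PROPOSITION 2.2, SECOND ENTRY OF (2.67) (`∇^η_xG′λ`), FOR THE GENUINE `k`-LEVEL OPERATOR `G′ = Δ′_a^{−1}` ON
THE TORUS `T_η`**: there are `δ₀, C, M₀ > 0` and `N₀ ≥ 1` (functions of `d`, `ℓ` and the windows — not of the torus) such
that for EVERY number of levels `k`, `M_h ≥ 3` with `L·M_h ≥ M₀` («M is sufficiently large»), `R ≥ 2L` with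
`RM ≥ N₀ + 1` ((2.59)), torus size `P` (`P_μ ≥ 4`), nested family `D` of domains of the torus (2.1)–(2.2), weights
`a_i ∈ [a₋, a₊]`, `c_i ∈ [c₋, c₊]` with `a_{i+1} = aNext ℓ a_i c_i`, and every axis `μ`:
`|(G′λ)(x + e_μ) − (G′λ)(x)| ≤ C·L^{j}·e^{−½δ₀d_T(y,y′)}·|λ|` for `x ∈ B^j(y)`, `y ∈ Λ_j`, `supp λ ⊂ B^{j′}(y′)`
(`x + e_μ` on the torus; `HasMajorant` of `∂_μG′` on `geomT D`; lattice units: `L^{j}` for «L^jη») — by the printed route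
applied to the differentiated fixed point `∂G′ = ∂G′₀ + (∂G′)R`: the majorants of `R` ((2.64), file T4) and of `∂G′₀`
(§4), Lemma 2.1 on the torus (file T3) and the chain (2.64)–(2.66) (`B6Prop23Chain.majorant_of_fixedPoint_266W`).
[cite: Balaban1984PropagatorsII, Proposition 2.2 (2.67) p.234 (second entry), (2.64)–(2.66) p.234, p.224 (Ω₁ = T_η admitted)] -/
theorem prop22_second_multiLevelTorus (d ℓ : ℕ) (hℓ : 1 ≤ ℓ) (aminus aplus a2minus a2plus : ℝ) (ha : 0 < aminus)
    (ha2 : 0 < a2minus) :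
    ∃ δ₀ C M₀ : ℝ, ∃ N₀ : ℕ, 0 < δ₀ ∧ 0 < C ∧ 0 < M₀ ∧ 0 < N₀ ∧
      ∀ (k Mh R : ℕ), 3 ≤ Mh → M₀ ≤ ((ℓ : ℝ) + 1) * Mh → 2 * (ℓ + 1) ≤ R → N₀ + 1 ≤ R * ((ℓ + 1) * Mh) →
      ∀ (P : Fin (d + 1) → ℕ) (hP : ∀ μ, 1 ≤ P μ) (hP4 : ∀ μ, 4 ≤ P μ) (D : TDomains d ℓ Mh k P R) (a c : ℕ → ℝ),
        (∀ i, 1 ≤ i → aminus ≤ a i ∧ a i ≤ aplus) → (∀ i, 1 ≤ i → a2minus ≤ c i ∧ c i ≤ a2plus) →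
        (∀ i, 1 ≤ i → a (i + 1) = aNext ℓ (a i) (c i)) → ∀ μ : Fin (d + 1),
        HasMajorant (g := geomT D) (blkOf D.toDomains)
          (Matrix.toLin' (dT (N0 ℓ Mh k P) μ * gmlT (N0 ℓ Mh k P) ℓ k D.lev a))
          (fun y y' => C * ((ℓ : ℝ) + 1) ^ y.1.1 * Real.exp (-(δ₀ / 2 * (geomT D).dist y y'))) := by
  obtain ⟨δ₁, K, hδ₁, hK, hRmaj⟩ := rT_majorant d ℓ hℓ aminus aplus a2minus a2plus ha ha2
  obtain ⟨δ₂, A, hδ₂, hA, hGmaj⟩ := dT_gZeroT_majorant d ℓ hℓ aminus aplus a2minus a2plus ha ha2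
  have hL0 : (0 : ℝ) < (ℓ : ℝ) + 1 := by positivity
  have hL1 : (1 : ℝ) ≤ (ℓ : ℝ) + 1 := by linarith [(Nat.cast_nonneg ℓ : (0 : ℝ) ≤ ℓ)]
  -- the rate `δ₀ = min(δ₁, δ₂)/(d+1)` and the (2.59)-threshold `N₀`
  set δ₀ : ℝ := min δ₁ δ₂ / (d + 1) with hδ₀
  have hδ₀pos : 0 < δ₀ := by rw [hδ₀]; exact div_pos (lt_min hδ₁ hδ₂) (by positivity)
  set N₀ : ℕ := ⌈4 * ((d : ℝ) + 1) * ((ℓ : ℝ) + 1) / (1 / 2 * δ₀)⌉₊ + 1 with hN₀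
  have hN₀pos : 0 < N₀ := by rw [hN₀]; omega
  have hθlt : Real.exp (-(1 / 2 * δ₀)) * ((ℓ : ℝ) + 1) ^ ((2 * (d + 1 : ℕ) : ℝ) / N₀) < 1 := by
    refine theta_lt_one_of_log hL0 hN₀pos ?_
    have hlog : Real.log ((ℓ : ℝ) + 1) ≤ (ℓ : ℝ) + 1 := (Real.log_le_sub_one_of_pos hL0).trans (by linarith)
    have hN₀ge : 4 * ((d : ℝ) + 1) * ((ℓ : ℝ) + 1) / (1 / 2 * δ₀) < (N₀ : ℝ) := by
      rw [hN₀]; push_cast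
      exact lt_of_le_of_lt (Nat.le_ceil _) (by linarith)
    have hσ : (0 : ℝ) < 1 / 2 * δ₀ := by positivity
    rw [div_lt_iff₀ hσ] at hN₀ge
    push_cast
    nlinarith [mul_nonneg (by positivity : (0 : ℝ) ≤ 2 * ((d : ℝ) + 1)) (Real.log_nonneg hL1)]
  -- the (2.61)-constant and «M sufficiently large»
  set cK : ℝ := K261 N₀ (d + 1) ((ℓ : ℝ) + 1) 1 (1 / 2 * δ₀) with hcK
  have hcK0 : 0 ≤ cK := K261_nonneg (by positivity) zero_le_one
  set M₀ : ℝ := 2 * K * cK + 1 with hM₀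
  refine ⟨δ₀, 2 * A * cK + 1, M₀, N₀, hδ₀pos, by positivity, by positivity, hN₀pos, ?_⟩
  intro k Mh R hMh hM hR hRM P hP hP4 D a c haw hcw hac μ
  have hMh1 : 1 ≤ Mh := le_trans (by norm_num) hMh
  have hMpos : (0 : ℝ) < ((ℓ : ℝ) + 1) * Mh := by
    have : (1 : ℝ) ≤ Mh := by exact_mod_cast hMh1
    positivity
  -- the majorants of `R` and `∂G′₀`, at the common rate `δ₀`
  set θ : ℝ := K / (((ℓ : ℝ) + 1) * Mh) with hθ
  have hθ0 : 0 ≤ θ := by positivity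
  have hdnn : ∀ y y' : (geomT D).Site, 0 ≤ (geomT D).dist y y' := (triangle_refl_nonneg_T D hMh1 hP).2.2
  have hrate : ∀ (δ : ℝ), min δ₁ δ₂ ≤ δ → ∀ y y' : (geomT D).Site,
      Real.exp (-(δ / (d + 1) * (geomT D).dist y y')) ≤ Real.exp (-(δ₀ * (geomT D).dist y y')) := by
    intro δ hδ y y'
    rw [Real.exp_le_exp, hδ₀, neg_le_neg_iff]
    exact mul_le_mul_of_nonneg_right (div_le_div_of_nonneg_right hδ (by positivity)) (hdnn y y')
  have hRm : HasMajorant (g := geomT D) (blkOf D.toDomains) (Matrix.toLin' (rT D a c hP hP4))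
      (fun y y' => θ * Real.exp (-(δ₀ * (geomT D).dist y y'))) :=
    hasMajorant_mono (blkOf D.toDomains) (hRmaj k Mh R hMh hR P hP hP4 D a c haw hcw) fun y y' =>
      mul_le_mul_of_nonneg_left (hrate δ₁ (min_le_left _ _) y y') hθ0
  have hGm : HasMajorant (g := geomT D) (blkOf D.toDomains)
      (Matrix.toLin' (dT (N0 ℓ Mh k P) μ * gZeroT D a c hP hP4))
      (fun y y' => A * ((ℓ : ℝ) + 1) ^ y.1.1 * Real.exp (-(δ₀ * (geomT D).dist y y'))) :=
    hasMajorant_mono (blkOf D.toDomains) (hGmaj k Mh R hMh hR P hP hP4 D a c haw hcw μ) fun y y' =>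
      mul_le_mul_of_nonneg_left (hrate δ₂ (min_le_right _ _) y y') (by positivity)
  -- Lemma 2.1 on the torus with `α = ½`
  obtain ⟨-, h261, -, h263⟩ := lemma21_torus D hMh1 hP hN₀pos hRM hδ₀pos.le (α := 1 / 2) (by norm_num)
    (by norm_num) hθlt
  obtain ⟨htri, hrefl, -⟩ := triangle_refl_nonneg_T D hMh1 hP
  -- the smallness `θ·c < 1` from `M ≥ M₀`
  have hsmall : θ * cK ≤ 1 / 2 := by
    rw [hθ, div_mul_eq_mul_div, div_le_iff₀ hMpos]
    have : 2 * K * cK + 1 ≤ ((ℓ : ℝ) + 1) * Mh := hM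
    nlinarith
  have hsmall' : θ * cK < 1 := by linarith
  -- the differentiated fixed point and the chain
  have hfix := fixedPoint_dT_gmlT D (c := c) hℓ hR hP hP4 hMh1 (fun i hi => lt_of_lt_of_le ha (haw i hi).1)
    (fun i hi => lt_of_lt_of_le ha2 (hcw i hi).1) hac μ
  have hchain := majorant_of_fixedPoint_266W (g := geomT D) (blkOf D.toDomains) cK δ₀ (1 / 2) θ A
    (fun y => ((ℓ : ℝ) + 1) ^ y.1.1) hA.le (fun y => by positivity) hθ0 hcK0
    (by nlinarith [hδ₀pos.le] : (0 : ℝ) ≤ (1 - 1 / 2) * δ₀) htri hrefl hdnn h261 h263 hsmall' hGm hRm hfix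
  refine hasMajorant_mono (g := geomT D) (blkOf D.toDomains) hchain fun y y' => ?_
  have hinv : (1 - θ * cK)⁻¹ ≤ 2 := by
    rw [inv_le_comm₀ (by linarith) (by norm_num)]; linarith
  have hexp0 : 0 ≤ Real.exp (-((1 - 1 / 2) * δ₀ * (geomT D).dist y y')) := (Real.exp_pos _).le
  have hP0 : 0 ≤ ((ℓ : ℝ) + 1) ^ y.1.1 := by positivity
  have hrate2 : Real.exp (-((1 - 1 / 2) * δ₀ * (geomT D).dist y y'))
      = Real.exp (-(δ₀ / 2 * (geomT D).dist y y')) := by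
    congr 1; ring
  rw [← hrate2]
  have h1 : A * cK * (1 - θ * cK)⁻¹ ≤ 2 * A * cK + 1 := by
    have : A * cK * (1 - θ * cK)⁻¹ ≤ A * cK * 2 := mul_le_mul_of_nonneg_left hinv (by positivity)
    linarith
  calc A * cK * (1 - θ * cK)⁻¹ * ((ℓ : ℝ) + 1) ^ y.1.1 * Real.exp (-((1 - 1 / 2) * δ₀ * (geomT D).dist y y'))
      = A * cK * (1 - θ * cK)⁻¹
          * (((ℓ : ℝ) + 1) ^ y.1.1 * Real.exp (-((1 - 1 / 2) * δ₀ * (geomT D).dist y y'))) := by ring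
    _ ≤ (2 * A * cK + 1) * (((ℓ : ℝ) + 1) ^ y.1.1 * Real.exp (-((1 - 1 / 2) * δ₀ * (geomT D).dist y y'))) :=
        mul_le_mul_of_nonneg_right h1 (mul_nonneg hP0 hexp0)
    _ = (2 * A * cK + 1) * ((ℓ : ℝ) + 1) ^ y.1.1 * Real.exp (-((1 - 1 / 2) * δ₀ * (geomT D).dist y y')) := by
        ring

end Prop22

end

end Literature.MathematicalPhysics.QuantumFieldTheory.Balaban1983to89.B6Prop22DerivMultiLevelTorus
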